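import Mathlib

/-!
# Venture YMGap, track Y3 FLOW-DATA — the RELATIVE kinetic-tail certificate («TAIL-R») of lineage A, part 1: Loewner algebra

HONEST FRAMING: venture file of the cell `pub-ymgap` (QuantumFields programme), track Y3.  Finite real linear
algebra only; nothing here is a statement about Yang–Mills, a continuum limit or a mass gap.

Lineage A (flow-eng-1, engine «sntm» v2.4, HOME/pub-ymgap-flow-eng-1/ENGINE.md §10) replaces the ABSOLUTE kinetic
tail of the K-weight tail theorem (`KWeightTail`, TAIL-A: `λ↓_k(S) ≤ λ↓_k(S_T) + κ_T Ω`, the slack set by the PEAK `Ω`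
of the plaquette weight) by a Schur-complement / block-domination bound in which the peak only enters a THRESHOLD.
With `P` the (diagonal) projector onto the kept coordinates, `Q = 1 − P`, `S = D V D` (`D = diag(d)`, `d = √K`,
`V` the symmetric plaquette-weight matrix), and any `δ > 0`, this file proves the Loewner-order inequalities:

* `block_domination`:  `S ⪯ P S P + δ⁻¹ P S Q S P + Q S Q + δ Q`  (the difference is a Gram matrix);
* `offDiag_sq_le`:     `P S Q S P ⪯ κ · P D V Q V D P`  when `d_i² ≤ κ` off the kept set (`Q K Q ⪯ κ Q`);
* `offDiag_split`:     `P D V Q V D P = P D V V D P − (P D V P)(P V D P)`  (second moment minus the part of `V` that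
                       stays inside the kept set — the engine's `(W²)_S − F Fᴴ`);
* `corner_le`:         `Q S Q ⪯ (κ Ω) Q`  when moreover `V ⪯ Ω 1`;
* `gram_lower`:        `(1 − s) F̃F̃ᴴ − (s⁻¹ − 1) E Eᴴ ⪯ (F̃ + E)(F̃ + E)ᴴ`  (`0 < s`), the engine's way of
                       bounding `F Fᴴ` from below by the BUILT `F̃`;
* `psd_le_blocks_sum` / `psd_le_of_shell_split`: `C ⪰ 0`, `RCR ⪯ a·1`, `(1−R)C(1−R) ⪯ b·1 ⇒ C ⪯ (a+b)·1` — the SHELL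
                       split of the dropped corner (ENGINE.md §10.8: `a` from a crude upper build on the shell, `b` = deep tail).

The eigenvalue consequences (threshold merge `λ↓_k(A + θ Q) ≤ max(λ↓_k(A), θ)` and the TAIL-R level bound
`λ↓_k(S) ≤ max(λ↓_k(A'), κ Ω + δ)`) are in the companion file `RelativeKineticTailLevelBound.lean`.
Real symmetric matrices throughout.  The float→exact step (`RitzDeflation.block_enclosure`) and the Bessel-tail
domination of the computed `2β` build are NOT restated here.

References: R. A. Horn, C. R. Johnson, *Matrix Analysis*, 2nd ed. (2013), Cor. 4.3.12, §7.7 (Schur complements and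
the Loewner order) [cite: HornJohnson2013, Cor 4.3.12; Thm 7.7.7]; the cell's HOME/pub-ymgap-flow-eng-1/ENGINE.md §10
and `sntm_v24/tailr.py` (2026-08-24).
-/

noncomputable section

open Matrix Finset
open scoped BigOperators

namespace Summit.Ventures.YMGap.FlowData

namespace RelativeKineticTail


variable {m : Type*} [Fintype m] [DecidableEq m]

/-! ### §1 Loewner algebra -/

omit [Fintype m] in
/-- For a symmetric `P`, `Q = 1 − P` is symmetric. [folklore] -/
theorem isHermitian_one_sub {P : Matrix m m ℝ} (hP : P.IsHermitian) : (1 - P).IsHermitian :=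
  isHermitian_one.sub hP

/-- For an idempotent `P`, `Q = 1 − P` is idempotent. [folklore] -/
theorem one_sub_mul_one_sub {P : Matrix m m ℝ} (hP2 : P * P = P) : (1 - P) * (1 - P) = 1 - P := by
  simp [Matrix.sub_mul, Matrix.mul_sub, hP2]

omit [DecidableEq m] in
/-- (scalar bookkeeping) `(a • A) (b • B) = (a b) • (A B)`. [folklore] -/
theorem smul_mul_smul' (a b : ℝ) (A B : Matrix m m ℝ) : (a • A) * (b • B) = (a * b) • (A * B) := by
  rw [Matrix.smul_mul, Matrix.mul_smul, smul_smul]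

/-- ★ **Block domination** (the Schur-complement step of TAIL-R): for a symmetric `S`, a symmetric idempotent
`P`, `Q = 1 − P` and `δ > 0`,
`S ⪯ P S P + δ⁻¹ · P S Q S P + Q S Q + δ · Q`; indeed the difference is the Gram matrix `Xᴴ X` of
`X = δ^{-1/2} Q S P − δ^{1/2} Q`. [cite: HornJohnson2013, Thm 7.7.7] -/
theorem block_domination {S P : Matrix m m ℝ} (hS : S.IsHermitian) (hP : P.IsHermitian) (hP2 : P * P = P)
    {δ : ℝ} (hδ : 0 < δ) :
    (P * S * P + δ⁻¹ • (P * S * (1 - P) * S * P) + (1 - P) * S * (1 - P) + δ • (1 - P) - S).PosSemidef := by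
  set Q : Matrix m m ℝ := 1 - P with hQdef
  clear_value Q
  have hQ : Q.IsHermitian := by rw [hQdef]; exact isHermitian_one_sub hP
  have hQ2 : Q * Q = Q := by rw [hQdef]; exact one_sub_mul_one_sub hP2
  obtain ⟨b, hbpos, hb2⟩ : ∃ b : ℝ, 0 < b ∧ b * b = δ := ⟨Real.sqrt δ, Real.sqrt_pos.mpr hδ, Real.mul_self_sqrt hδ.le⟩
  set a : ℝ := b⁻¹ with ha
  clear_value a
  have hab : a * b = 1 := by rw [ha]; exact inv_mul_cancel₀ hbpos.ne'
  have hba : b * a = 1 := by rw [mul_comm]; exact hab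
  have ha2 : a * a = δ⁻¹ := by rw [ha, ← mul_inv, hb2]
  set X : Matrix m m ℝ := a • (Q * S * P) - b • Q with hX
  have hXh : Xᴴ = a • (P * S * Q) - b • Q := by
    rw [hX, conjTranspose_sub, conjTranspose_smul, conjTranspose_smul, conjTranspose_mul, conjTranspose_mul,
      hS.eq, hP.eq, hQ.eq]
    simp [Matrix.mul_assoc]
  have hgram : (Xᴴ * X).PosSemidef := posSemidef_conjTranspose_mul_self X
  -- the decomposition S = PSP + PSQ + QSP + QSQ
  have hPQ1 : P + Q = 1 := by rw [hQdef]; abel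
  have hSdec : S = P * S * P + P * S * Q + Q * S * P + Q * S * Q := by
    have e : (P + Q) * S * (P + Q) = P * S * P + P * S * Q + Q * S * P + Q * S * Q := by noncomm_ring
    rwa [hPQ1, Matrix.one_mul, Matrix.mul_one] at e
  -- the four products
  have t1 : (a • (P * S * Q)) * (a • (Q * S * P)) = δ⁻¹ • (P * S * Q * S * P) := by
    rw [smul_mul_smul', ha2]
    congr 1
    simp only [Matrix.mul_assoc]
    rw [← Matrix.mul_assoc Q Q, hQ2]
  have t2 : (a • (P * S * Q)) * (b • Q) = P * S * Q := by
    rw [smul_mul_smul', hab, one_smul, Matrix.mul_assoc, hQ2]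
  have t3 : (b • Q) * (a • (Q * S * P)) = Q * S * P := by
    rw [smul_mul_smul', hba, one_smul, ← Matrix.mul_assoc, ← Matrix.mul_assoc, hQ2]
  have t4 : (b • Q) * (b • Q) = δ • Q := by
    rw [smul_mul_smul', hb2, hQ2]
  have hexp : Xᴴ * X = δ⁻¹ • (P * S * Q * S * P) - P * S * Q - Q * S * P + δ • Q := by
    rw [hXh, hX, Matrix.sub_mul, Matrix.mul_sub, Matrix.mul_sub, t1, t2, t3, t4]
    abel
  have key : P * S * P + δ⁻¹ • (P * S * Q * S * P) + Q * S * Q + δ • Q - S = Xᴴ * X := by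
    rw [hexp]
    conv_lhs => arg 2; rw [hSdec]
    abel
  rw [key]
  exact hgram

/-- **Second moment minus the kept part**: `P D V Q V D P = P D V V D P − (P D V P)(P V D P)` for `Q = 1 − P`,
`P` idempotent. (The engine's `(W²)_S − F Fᴴ`, ENGINE.md §10.1 (2).) [folklore] -/
theorem offDiag_split {P D V : Matrix m m ℝ} (hP2 : P * P = P) :
    P * D * V * (1 - P) * V * D * P = P * D * (V * V) * D * P - (P * D * V * P) * (P * V * D * P) := by
  have : (P * D * V * P) * (P * V * D * P) = P * D * V * P * V * D * P := by
    simp only [Matrix.mul_assoc]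
    rw [← Matrix.mul_assoc P P, hP2]
  rw [this]
  simp only [Matrix.mul_sub, Matrix.sub_mul, Matrix.mul_one, Matrix.mul_assoc]

omit [Fintype m] in
/-- The diagonal kept-set projector is symmetric. [folklore] -/
theorem isHermitian_keptProj (p : m → Prop) [DecidablePred p] :
    (diagonal fun i => if p i then (1 : ℝ) else 0 : Matrix m m ℝ).IsHermitian :=
  isHermitian_diagonal_of_self_adjoint _ (IsSelfAdjoint.all _)

/-- The diagonal kept-set projector is idempotent. [folklore] -/
theorem keptProj_mul_self (p : m → Prop) [DecidablePred p] :
    (diagonal fun i => if p i then (1 : ℝ) else 0 : Matrix m m ℝ) *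
      (diagonal fun i => if p i then (1 : ℝ) else 0) = diagonal fun i => if p i then (1 : ℝ) else 0 := by
  rw [diagonal_mul_diagonal]
  congr 1; funext i; split_ifs <;> simp

omit [Fintype m] in
/-- `1 − P = diag([i ∉ p])`. [folklore] -/
theorem compl_eq_diagonal (p : m → Prop) [DecidablePred p] :
    (1 : Matrix m m ℝ) - (diagonal fun i => if p i then (1 : ℝ) else 0)
      = diagonal fun i => if p i then (0 : ℝ) else 1 := by
  rw [← diagonal_one, diagonal_sub]
  congr 1; funext i; split_ifs <;> simp

omit [Fintype m] in
/-- `c • diag(f) = diag(c f)`. [folklore] -/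
theorem smul_diagonal' (c : ℝ) (f : m → ℝ) : c • (diagonal f : Matrix m m ℝ) = diagonal fun i => c * f i := by
  rw [← diagonal_smul]; rfl

/-- `D Q D = diag(d_i² · [i ∉ p])` for diagonal `D = diag d` and `Q = 1 −` the kept projector. [folklore] -/
theorem diag_mul_compl_mul_diag (p : m → Prop) [DecidablePred p] (d : m → ℝ) :
    diagonal d * (1 - diagonal fun i => if p i then (1 : ℝ) else 0) * diagonal d
      = diagonal fun i => if p i then 0 else d i * d i := by
  rw [compl_eq_diagonal, diagonal_mul_diagonal, diagonal_mul_diagonal]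
  congr 1; funext i; split_ifs <;> simp

/-- **Off-diagonal square bound**: with `S = D V D` (`D = diag d`, `V` symmetric), the kept projector `P`,
`Q = 1 − P`, and `d_i² ≤ κ` off the kept set (`Q K Q ⪯ κ Q`):  `P S Q S P ⪯ κ · P D V Q V D P`.
(ENGINE.md §10.1 (2): `B B* ⪯ κ_T · P K^½ W Q W K^½ P`.) [cite: HornJohnson2013, Cor 4.3.12] -/
theorem offDiag_sq_le (p : m → Prop) [DecidablePred p] {V : Matrix m m ℝ} (hV : V.IsHermitian) (d : m → ℝ)
    {κ : ℝ} (hκ : ∀ i, ¬ p i → d i * d i ≤ κ) :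
    (κ • ((diagonal fun i => if p i then (1 : ℝ) else 0) * diagonal d * V *
            (1 - diagonal fun i => if p i then (1 : ℝ) else 0) * V * diagonal d *
            (diagonal fun i => if p i then (1 : ℝ) else 0))
      - (diagonal fun i => if p i then (1 : ℝ) else 0) * (diagonal d * V * diagonal d) *
            (1 - diagonal fun i => if p i then (1 : ℝ) else 0) * (diagonal d * V * diagonal d) *
            (diagonal fun i => if p i then (1 : ℝ) else 0)).PosSemidef := by
  set P : Matrix m m ℝ := diagonal fun i => if p i then (1 : ℝ) else 0 with hPdef
  set D : Matrix m m ℝ := diagonal d with hDdef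
  set Q : Matrix m m ℝ := 1 - P with hQdef
  clear_value Q D P
  have hDh : D.IsHermitian := by rw [hDdef]; exact isHermitian_diagonal_of_self_adjoint _ (IsSelfAdjoint.all _)
  have hPh : P.IsHermitian := by rw [hPdef]; exact isHermitian_keptProj p
  -- E := D Q D = diag(d² off p);  κ Q − E ⪰ 0
  set E : Matrix m m ℝ := diagonal fun i => if p i then 0 else d i * d i with hEdef
  clear_value E
  have hDQD : D * Q * D = E := by rw [hDdef, hQdef, hPdef, hEdef]; exact diag_mul_compl_mul_diag p d
  have hQ1 : Q = diagonal fun i => if p i then (0:ℝ) else 1 := by rw [hQdef, hPdef]; exact compl_eq_diagonal p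
  have hdiag : (κ • Q - E).PosSemidef := by
    have h1 : κ • Q - E = diagonal fun i => if p i then (0:ℝ) else κ - d i * d i := by
      rw [hQ1, hEdef, smul_diagonal', diagonal_sub]
      congr 1; funext i; split_ifs <;> simp
    rw [h1]
    refine PosSemidef.diagonal (fun i => ?_)
    split_ifs with hi
    · exact le_rfl
    · exact sub_nonneg.mpr (hκ i hi)
  -- Y := V D P ;  Yᴴ (κ Q − E) Y ⪰ 0
  set Y : Matrix m m ℝ := V * D * P with hY
  clear_value Y
  have hYh : Yᴴ = P * D * V := by
    rw [hY, conjTranspose_mul, conjTranspose_mul, hV.eq, hDh.eq, hPh.eq, Matrix.mul_assoc]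
  have hconj : (Yᴴ * (κ • Q - E) * Y).PosSemidef := hdiag.conjTranspose_mul_mul_same Y
  have key : κ • (P * D * V * Q * V * D * P) - P * (D * V * D) * Q * (D * V * D) * P
      = Yᴴ * (κ • Q - E) * Y := by
    rw [hYh, hY, Matrix.mul_sub, Matrix.sub_mul, Matrix.mul_smul, Matrix.smul_mul]
    have e1 : P * (D * V * D) * Q * (D * V * D) * P = P * D * V * (D * Q * D) * V * D * P := by
      simp only [Matrix.mul_assoc]
    rw [e1, hDQD]
    simp only [Matrix.mul_assoc]
  rw [key]
  exact hconj

/-- **Corner bound**: `Q S Q ⪯ (κ Ω) · Q` when `V ⪯ Ω · 1` and `d_i² ≤ κ` off the kept set, `0 ≤ Ω`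
(ENGINE.md §10.1 (2): `‖C‖ ≤ κ_T R^{N_sp}`). [cite: HornJohnson2013, Cor 4.3.12] -/
theorem corner_le (p : m → Prop) [DecidablePred p] (V : Matrix m m ℝ) (d : m → ℝ)
    {κ Ω : ℝ} (hκ : ∀ i, ¬ p i → d i * d i ≤ κ) (hΩ : 0 ≤ Ω) (hVΩ : (Ω • (1 : Matrix m m ℝ) - V).PosSemidef) :
    ((κ * Ω) • (1 - diagonal fun i => if p i then (1 : ℝ) else 0)
      - (1 - diagonal fun i => if p i then (1 : ℝ) else 0) * (diagonal d * V * diagonal d) *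
          (1 - diagonal fun i => if p i then (1 : ℝ) else 0)).PosSemidef := by
  set P : Matrix m m ℝ := diagonal fun i => if p i then (1 : ℝ) else 0 with hPdef
  set D : Matrix m m ℝ := diagonal d with hDdef
  set Q : Matrix m m ℝ := 1 - P with hQdef
  clear_value Q D P
  have hQh : Q.IsHermitian := by rw [hQdef, hPdef]; exact isHermitian_one_sub (isHermitian_keptProj p)
  have hDh : D.IsHermitian := by rw [hDdef]; exact isHermitian_diagonal_of_self_adjoint _ (IsSelfAdjoint.all _)
  set E : Matrix m m ℝ := diagonal fun i => if p i then 0 else d i * d i with hEdef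
  clear_value E
  have hQ1 : Q = diagonal fun i => if p i then (0:ℝ) else 1 := by rw [hQdef, hPdef]; exact compl_eq_diagonal p
  -- (DQ)ᴴ (Ω 1 − V) (DQ) ⪰ 0, i.e. Ω Q D D Q − Q D V D Q ⪰ 0
  set Y : Matrix m m ℝ := D * Q with hY
  clear_value Y
  have hYh : Yᴴ = Q * D := by rw [hY, conjTranspose_mul, hDh.eq, hQh.eq]
  have h1 : (Yᴴ * (Ω • (1 : Matrix m m ℝ) - V) * Y).PosSemidef := hVΩ.conjTranspose_mul_mul_same Y
  have h1' : Yᴴ * (Ω • (1 : Matrix m m ℝ) - V) * Y = Ω • (Q * D * D * Q) - Q * (D * V * D) * Q := by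
    rw [hYh, hY, Matrix.mul_sub, Matrix.sub_mul, Matrix.mul_smul, Matrix.smul_mul, Matrix.mul_one]
    simp only [Matrix.mul_assoc]
  rw [h1'] at h1
  have hQDDQ : Q * D * D * Q = E := by
    rw [hQ1, hDdef, hEdef, diagonal_mul_diagonal, diagonal_mul_diagonal, diagonal_mul_diagonal]
    congr 1; funext i; split_ifs <;> simp
  have h2 : ((κ * Ω) • Q - Ω • (Q * D * D * Q)).PosSemidef := by
    rw [hQDDQ, hQ1, hEdef, smul_diagonal', smul_diagonal', diagonal_sub]
    refine PosSemidef.diagonal (fun i => ?_)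
    have hdi := hκ i
    split_ifs with hi
    · simp
    · have h3 : 0 ≤ Ω * (κ - d i * d i) := mul_nonneg hΩ (sub_nonneg.mpr (hdi hi))
      have h4 : Ω * (κ - d i * d i) = κ * Ω * 1 - Ω * (d i * d i) := by ring
      rw [← h4]; exact h3
  have hsum := h2.add h1
  have e : (κ * Ω) • Q - Q * (D * V * D) * Q
      = ((κ * Ω) • Q - Ω • (Q * D * D * Q)) + (Ω • (Q * D * D * Q) - Q * (D * V * D) * Q) := by
    abel
  rw [e]
  exact hsum

omit [DecidableEq m] in
/-- **Gram lower bound by a built approximation**: for `F = F̃ + E` and `0 < s`,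
`(1 − s) F̃F̃ᴴ − (s⁻¹ − 1) E Eᴴ ⪯ F Fᴴ`; indeed the difference is the Gram matrix of `√s F̃ + E/√s`
(ENGINE.md §10.2 (c)). [folklore] -/
theorem gram_lower {k : Type*} [Fintype k] (Ft E : Matrix m k ℝ) {s : ℝ} (hs : 0 < s) :
    ((Ft + E) * (Ft + E)ᴴ - ((1 - s) • (Ft * Ftᴴ) - (s⁻¹ - 1) • (E * Eᴴ))).PosSemidef := by
  set a : ℝ := Real.sqrt s with ha
  have ha2 : a * a = s := Real.mul_self_sqrt hs.le
  have hapos : 0 < a := Real.sqrt_pos.mpr hs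
  set X : Matrix m k ℝ := a • Ft + a⁻¹ • E with hX
  have hgram : (X * Xᴴ).PosSemidef := posSemidef_self_mul_conjTranspose X
  have hinv : a⁻¹ * a⁻¹ = s⁻¹ := by rw [← mul_inv, ha2]
  have haa : a * a⁻¹ = 1 := mul_inv_cancel₀ hapos.ne'
  have haa' : a⁻¹ * a = 1 := inv_mul_cancel₀ hapos.ne'
  have t1 : (a • Ft) * (a • Ft)ᴴ = s • (Ft * Ftᴴ) := by
    rw [conjTranspose_smul, star_trivial, Matrix.smul_mul, Matrix.mul_smul, smul_smul, ha2]
  have t2 : (a • Ft) * (a⁻¹ • E)ᴴ = Ft * Eᴴ := by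
    rw [conjTranspose_smul, star_trivial, Matrix.smul_mul, Matrix.mul_smul, smul_smul, haa, one_smul]
  have t3 : (a⁻¹ • E) * (a • Ft)ᴴ = E * Ftᴴ := by
    rw [conjTranspose_smul, star_trivial, Matrix.smul_mul, Matrix.mul_smul, smul_smul, haa', one_smul]
  have t4 : (a⁻¹ • E) * (a⁻¹ • E)ᴴ = s⁻¹ • (E * Eᴴ) := by
    rw [conjTranspose_smul, star_trivial, Matrix.smul_mul, Matrix.mul_smul, smul_smul, hinv]
  have hXX : X * Xᴴ = s • (Ft * Ftᴴ) + Ft * Eᴴ + E * Ftᴴ + s⁻¹ • (E * Eᴴ) := by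
    rw [hX, conjTranspose_add, Matrix.add_mul, Matrix.mul_add, Matrix.mul_add, t1, t2, t3, t4]
    abel
  have hFF : (Ft + E) * (Ft + E)ᴴ = Ft * Ftᴴ + Ft * Eᴴ + E * Ftᴴ + E * Eᴴ := by
    rw [conjTranspose_add, Matrix.add_mul, Matrix.mul_add, Matrix.mul_add]
    abel
  have key : (Ft + E) * (Ft + E)ᴴ - ((1 - s) • (Ft * Ftᴴ) - (s⁻¹ - 1) • (E * Eᴴ)) = X * Xᴴ := by
    rw [hXX, hFF, sub_smul, sub_smul, one_smul, one_smul]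
    abel
  rw [key]; exact hgram

/-! ### §2 The shell split of the dropped corner (ENGINE.md §10.8) -/

/-- **Two-block bound for a PSD matrix, parametric form**: for `C ⪰ 0`, a symmetric `R`, `Q = 1 − R` and every
`t > 0`, `C ⪯ (1 + t) R C R + (1 + t⁻¹) Q C Q`; the difference is `Y C Y` with `Y = √t R − Q/√t` (idempotency of `R` is
not even needed here).
[cite: HornJohnson2013, Thm 7.7.7] -/
theorem psd_le_blocks_sum {C R : Matrix m m ℝ} (hC : C.PosSemidef) (hR : R.IsHermitian)
    {t : ℝ} (ht : 0 < t) :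
    ((1 + t) • (R * C * R) + (1 + t⁻¹) • ((1 - R) * C * (1 - R)) - C).PosSemidef := by
  set Q : Matrix m m ℝ := 1 - R with hQdef
  clear_value Q
  have hQ : Q.IsHermitian := by rw [hQdef]; exact isHermitian_one_sub hR
  have hRQ1 : R + Q = 1 := by rw [hQdef]; abel
  obtain ⟨a, hapos, ha2⟩ : ∃ a : ℝ, 0 < a ∧ a * a = t := ⟨Real.sqrt t, Real.sqrt_pos.mpr ht, Real.mul_self_sqrt ht.le⟩
  have hai : a⁻¹ * a⁻¹ = t⁻¹ := by rw [← mul_inv, ha2]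
  have haa : a * a⁻¹ = 1 := mul_inv_cancel₀ hapos.ne'
  have haa' : a⁻¹ * a = 1 := inv_mul_cancel₀ hapos.ne'
  set Y : Matrix m m ℝ := a • R - a⁻¹ • Q with hY
  have hYh : Yᴴ = Y := by
    rw [hY, conjTranspose_sub, conjTranspose_smul, conjTranspose_smul, hR.eq, hQ.eq]; simp
  have hpsd : (Yᴴ * C * Y).PosSemidef := hC.conjTranspose_mul_mul_same Y
  rw [hYh] at hpsd
  have hCdec : C = R * C * R + R * C * Q + Q * C * R + Q * C * Q := by
    have e : (R + Q) * C * (R + Q) = R * C * R + R * C * Q + Q * C * R + Q * C * Q := by noncomm_ring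
    rwa [hRQ1, Matrix.one_mul, Matrix.mul_one] at e
  have t1 : (a • R) * C * (a • R) = t • (R * C * R) := by
    rw [Matrix.smul_mul, Matrix.smul_mul, Matrix.mul_smul, smul_smul, ha2]
  have t2 : (a • R) * C * (a⁻¹ • Q) = R * C * Q := by
    rw [Matrix.smul_mul, Matrix.smul_mul, Matrix.mul_smul, smul_smul, haa, one_smul]
  have t3 : (a⁻¹ • Q) * C * (a • R) = Q * C * R := by
    rw [Matrix.smul_mul, Matrix.smul_mul, Matrix.mul_smul, smul_smul, haa', one_smul]
  have t4 : (a⁻¹ • Q) * C * (a⁻¹ • Q) = t⁻¹ • (Q * C * Q) := by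
    rw [Matrix.smul_mul, Matrix.smul_mul, Matrix.mul_smul, smul_smul, hai]
  have hexp : Y * C * Y = t • (R * C * R) - R * C * Q - Q * C * R + t⁻¹ • (Q * C * Q) := by
    rw [hY, Matrix.sub_mul, Matrix.sub_mul, Matrix.mul_sub, Matrix.mul_sub, t1, t2, t3, t4]
    abel
  have key : (1 + t) • (R * C * R) + (1 + t⁻¹) • (Q * C * Q) - C = Y * C * Y := by
    rw [hexp]
    conv_lhs => arg 2; rw [hCdec]
    rw [add_smul, add_smul, one_smul, one_smul]
    abel
  rw [key]
  exact hpsd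

/-- ★ **Shell split of the corner** (ENGINE.md §10.8): if `C ⪰ 0`, `R C R ⪯ a · 1` (the SHELL block, certified from a
crude upper build) and `Q C Q ⪯ b · 1` (the deep block, `b = (ε/ρ′) R^{N_sp}`), `a, b > 0`, then `C ⪯ (a + b) · 1`, i.e.
`‖C‖ ≤ a + b`. [cite: HornJohnson2013, Thm 7.7.7] -/
theorem psd_le_of_shell_split {C R : Matrix m m ℝ} (hC : C.PosSemidef) (hR : R.IsHermitian) (hR2 : R * R = R)
    {a b : ℝ} (ha : 0 < a) (hb : 0 < b) (haR : (a • (1 : Matrix m m ℝ) - R * C * R).PosSemidef)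
    (hbQ : (b • (1 : Matrix m m ℝ) - (1 - R) * C * (1 - R)).PosSemidef) :
    ((a + b) • (1 : Matrix m m ℝ) - C).PosSemidef := by
  set Q : Matrix m m ℝ := 1 - R with hQdef
  clear_value Q
  have hQ : Q.IsHermitian := by rw [hQdef]; exact isHermitian_one_sub hR
  have hQ2 : Q * Q = Q := by rw [hQdef]; exact one_sub_mul_one_sub hR2
  have hRQ1 : R + Q = 1 := by rw [hQdef]; abel
  set t : ℝ := b / a with htdef
  have ht : 0 < t := div_pos hb ha
  have h1t : (1 + t) * a = a + b := by rw [htdef]; field_simp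
  have h2t : (1 + t⁻¹) * b = a + b := by rw [htdef, inv_div]; field_simp; ring
  have X1 : ((1 + t) • (R * C * R) + (1 + t⁻¹) • (Q * C * Q) - C).PosSemidef := by
    have h := psd_le_blocks_sum hC hR ht
    rwa [← hQdef] at h
  -- R (a1 − RCR) R = aR − RCR ⪰ 0 and likewise for Q
  have hRR : ∀ X : Matrix m m ℝ, R * (R * X) = R * X := fun X => by rw [← Matrix.mul_assoc, hR2]
  have hQQ : ∀ X : Matrix m m ℝ, Q * (Q * X) = Q * X := fun X => by rw [← Matrix.mul_assoc, hQ2]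
  have hR3 : R * (R * C * R) * R = R * C * R := by
    simp only [Matrix.mul_assoc, hR2, hRR]
  have hQ3 : Q * (Q * C * Q) * Q = Q * C * Q := by
    simp only [Matrix.mul_assoc, hQ2, hQQ]
  have X2 : (a • R - R * C * R).PosSemidef := by
    have h := haR.conjTranspose_mul_mul_same R
    rwa [hR.eq, Matrix.mul_sub, Matrix.sub_mul, Matrix.mul_smul, Matrix.smul_mul, Matrix.mul_one, hR2, hR3] at h
  have X3 : (b • Q - Q * C * Q).PosSemidef := by
    have h := hbQ.conjTranspose_mul_mul_same Q
    rwa [hQ.eq, Matrix.mul_sub, Matrix.sub_mul, Matrix.mul_smul, Matrix.smul_mul, Matrix.mul_one, hQ2, hQ3] at h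
  have X2' : ((1 + t) • (a • R - R * C * R)).PosSemidef := X2.smul (by linarith)
  have X3' : ((1 + t⁻¹) • (b • Q - Q * C * Q)).PosSemidef := X3.smul (by positivity)
  have hsum := (X1.add X2').add X3'
  have key : (a + b) • (1 : Matrix m m ℝ) - C
      = ((1 + t) • (R * C * R) + (1 + t⁻¹) • (Q * C * Q) - C)
        + (1 + t) • (a • R - R * C * R) + (1 + t⁻¹) • (b • Q - Q * C * Q) := by
    rw [smul_sub, smul_sub, smul_smul, smul_smul, h1t, h2t, ← hRQ1, smul_add]
    abel
  rw [key]
  exact hsum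

end RelativeKineticTail

end Summit.Ventures.YMGap.FlowData
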